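import Summits.BirchSwinnertonDyer.BirchSwinnertonDyer.Theorems.TwistFamilyManinDescentRaynaudRegimeClassNoLocalPTorsion
import HarnessLib

/-!
# Route `TwistFamilyManinDescent`, LINE 16: `ℚ_p`-rational `p`-torsion on an additive `ℚ`-isogeny class READ OFF
# THE DEFECT `e` — the corollaries of S16a's class lemma beyond the Raynaud rows: `p ≥ 11` (never), `p = 7` with
# `e ≠ 6` (in particular the ORDINARY `e = 3` classes IV/IV* at `7`), `p = 5` with `e ∉ {4, 6}`, `e = 2` (I₀*), and
# the row form `(5; 4, 8) ∪ (7; 3, 4, 8, 9)` in the TFMD binder currency — `--supports`, helper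

Cell `pub/bsd-wall`, seat `bsd-line-ttd-p1` g7 (TTD seat working the planner-of-record's TFMD LINE 16). THEOREMS ONLY
(no definition, no named fact, no `sorry`). BSD is not proved by this; nothing is closed by this. The general class
lemma `TwistFamilyManinDescent.padicPoint_eq_zero_of_isIsogenous_of_semistabilityIndex` (p624109: `p ≥ 5`, `W`
globally minimal additive with `0 ≤ v_p j`; if `p = 5 → e ∉ {4, 6}` and `p = 7 → e ≠ 6` then `W'(ℚ_p)[p] = 0` for
every `W' ∼ W`, any model — Mazur's Step 1 at the additive prime + bsd-potss' isogeny invariance of `e`) is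
IMPORTED, not restated (gate `dedup.landed`); this file records what it gives off the four Raynaud rows of S16a
(`RaynaudRegimeClassNoLocalPTorsion`, stmt-27295), for the consumers that quantify over the LOCAL group `W'(ℚ_p)[p]`
of every member: the twisted-Vatsal engines (S16b `SupersingularKummerFreeStrongIsUnstarred` stmt-27296 at
`p ∈ {5, 7}`; LINE 14's S5″ «no rational `p`-torsion in the class» at `p = 13`, automatic by §1), the Kato-lever
receptacles of AKR (`…RTameTwistFull57*`, there only under `Irr` + Dokchitser–Dokchitser) and the EF57/TTD
Kummer-corner items.

* §1 `padicPoint_eq_zero_of_isIsogenous_of_addv_of_eleven_le` — `p ≥ 11`, `W` additive (any model, no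
  potentially-good hypothesis): `W'(ℚ_p)[p] = 0` for every `W' ∼ W`, any model. LOCAL twin of bsd-potss'
  `not_dvd_torsionOrder_of_isIsogenous_of_addv_of_eleven_le`.
* §2 `…_eq_two` (I₀* classes, any `p ≥ 5`), `…_seven_of_semistabilityIndex_ne_six` (every potentially good class
  at `7` off II/II*), `…_five_of_semistabilityIndex` (`e ∉ {4, 6}` at `5`), and the row form `…_of_rows` on
  `(5; v ∈ {4, 8}) ∪ (7; v ∈ {3, 4, 8, 9})` under the twist binder «`W ⊗ χ_{p*}` not semistable at `p`».

References: [Mazur1977] B. Mazur, Publ. Math. IHÉS 47 (1977), Ch. III §5 Step 1 (p. 158); [SilvermanAEC2009]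
III.3.1(b), VII.5 Prop. 5.1, Prop. VII.5.5, Cor. VII.7.2, VIII.8 Cor. 8.3; [SilvermanATAEC1994] IV Table 4.1, V.5.3;
[Serre1972] §5.6 (p. 312); [KostersPannekoek2017] Thm. 1, Cor. 2 (context: the exceptional additive curves with
`E(ℚ_p)[p] ≠ 0`). Design: no definitions; axioms `propext`, `Classical.choice`, `Quot.sound`.
-/

set_option autoImplicit false
-- the Theorems directory repeats the summit name (sibling precedent `TwistFamilyManinDescentRaynaudRegimeOfOrientation.lean`)
set_option linter.dupNamespace false

noncomputable section

open scoped Classical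

namespace Summit.BirchSwinnertonDyer.BirchSwinnertonDyer.Theorems.TwistFamilyManinDescent

open WeierstrassCurve Literature.NumberTheory.EllipticCurves
  Literature.NumberTheory.EllipticCurves.Rank1Residual
  Summit.BirchSwinnertonDyer.Rank1Residual
  Summit.BirchSwinnertonDyer.Rank1Residual.Additive

/-! ## §1 `p ≥ 11`: no member of an additive class has a `ℚ_p`-rational point of order `p` -/

section ElevenLe

variable {W W' : WeierstrassCurve ℚ} [W.IsElliptic] [W'.IsElliptic] {p : ℕ} [hp : Fact p.Prime]

/-- **At an additive `p ≥ 11`, no curve `ℚ`-isogenous to `W` (any model of either) has a `ℚ_p`-rational point of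
order `p`** — unconditional: additivity is a `ℚ`-isogeny invariant (*AEC* VII.7.2, `X2.addv_iff_of_isIsogenous`),
a globally minimal model `C • W'` (*AEC* VIII.8.3) carries the `ℚ_p`-points (`VariableChange.pointEquivBaseChange`),
and `E(ℚ_p)[p] = 0` at every additive `p ≥ 11` (Mazur's Step 1 at the additive prime, b2b
`eq_zero_of_prime_nsmul_eq_zero_of_addv_of_eleven_le`). LOCAL twin of bsd-potss'
`not_dvd_torsionOrder_of_isIsogenous_of_addv_of_eleven_le`. [cite: Mazur1977, Ch. III §5, Step 1, p. 158]
[cite: SilvermanAEC2009, III.3.1(b), Cor. VII.7.2, VIII.8 Cor. 8.3] -/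
theorem padicPoint_eq_zero_of_isIsogenous_of_addv_of_eleven_le (h11 : 11 ≤ p) (hadd : Addv W p)
    (hiso : IsIsogenous W W') (P : (W'.baseChange ℚ_[p]).toAffine.Point) (hP : p • P = 0) : P = 0 := by
  obtain ⟨C, hC⟩ := hasGlobalMinimalModel_rat_holds W'
  haveI := hC
  have hiso' : IsIsogenous W (C • W') := hiso.smul_right C
  have hadd' : Addv (C • W') p := (X2.addv_iff_of_isIsogenous (p := p) hiso').mp hadd
  set Q : ((C • W').baseChange ℚ_[p]).toAffine.Point :=
    VariableChange.pointEquivBaseChange W' C ℚ_[p] P with hQ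
  have hQp : p • Q = 0 := by rw [hQ, ← map_nsmul, hP, map_zero]
  have hQ0 : Q = 0 := eq_zero_of_prime_nsmul_eq_zero_of_addv_of_eleven_le (C • W') p h11 hadd' hQp
  rw [hQ] at hQ0
  exact (AddEquiv.map_eq_zero_iff _).mp hQ0

end ElevenLe

/-! ## §2 `p ∈ {5, 7}`: the classes off the exceptional defects, and the row form -/

section Defect

variable {W : WeierstrassCurve ℚ} [W.IsElliptic] [W.IsGloballyMinimal] {p : ℕ} [hp : Fact p.Prime]

/-- **An `e = 2` class (Kodaira I₀*) has NO member with a `ℚ_p`-rational point of order `p`** at any additive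
`p ≥ 5` (I₀* is potentially good: `0 ≤ v_p j` is a hypothesis here, automatic off `Iₙ*`, `n ≥ 1`); any model of the
member. UNCONDITIONAL. [cite: Mazur1977, Ch. III §5, Step 1, p. 158] [cite: SilvermanATAEC1994, IV Table 4.1 (PDF p. 365)] -/
theorem padicPoint_eq_zero_of_isIsogenous_of_semistabilityIndex_eq_two (hp5 : 5 ≤ p)
    (hadd : Addv W p) (hj : 0 ≤ padicValRat p W.j) (he : semistabilityIndex W p = 2)
    {W' : WeierstrassCurve ℚ} [W'.IsElliptic] (hiso : IsIsogenous W W')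
    (P : (W'.baseChange ℚ_[p]).toAffine.Point) (hP : p • P = 0) : P = 0 :=
  padicPoint_eq_zero_of_isIsogenous_of_semistabilityIndex hp5 hadd hj (fun _ ↦ by omega)
    (fun _ ↦ by omega) hiso P hP

/-- **At `p = 7`, every additive potentially good class with `e ≠ 6` (i.e. off Kodaira II/II*: types III, III*,
IV, IV*, I₀*) is free of `ℚ_7`-rational `7`-torsion on every member** — the exception at `7` is the type-II cell
`e = 6` only (`[−19, −100, −100, 0, 0]`, `N = 490`, II at `7`, carries a rational `7`-torsion point). UNCONDITIONAL.
[cite: Mazur1977, Ch. III §5, Step 1, p. 158] [cite: SilvermanATAEC1994, IV Table 4.1 (PDF p. 365)] -/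
theorem padicPoint_eq_zero_of_isIsogenous_seven_of_semistabilityIndex_ne_six (hp7 : p = 7)
    (hadd : Addv W p) (hj : 0 ≤ padicValRat p W.j) (he : semistabilityIndex W p ≠ 6)
    {W' : WeierstrassCurve ℚ} [W'.IsElliptic] (hiso : IsIsogenous W W')
    (P : (W'.baseChange ℚ_[p]).toAffine.Point) (hP : p • P = 0) : P = 0 :=
  padicPoint_eq_zero_of_isIsogenous_of_semistabilityIndex (by omega) hadd hj (fun h ↦ by omega)
    (fun _ ↦ he) hiso P hP

/-- **At `p = 5`, every additive potentially good class with `e ∉ {4, 6}` (i.e. Kodaira IV, IV*, I₀*) is free of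
`ℚ_5`-rational `5`-torsion on every member** — the exceptions at `5` are the cells II/II* (`e = 6`: e.g.
`y² − 2xy − 3y = x³ − 3x²`, `N = 75`, II at `5`, `(0,0)` of order `5`) and III/III* (`e = 4`, the Kosters–Pannekoek
corner). UNCONDITIONAL. [cite: Mazur1977, Ch. III §5, Step 1, p. 158]
[cite: SilvermanATAEC1994, IV Table 4.1 (PDF p. 365)] [cite: KostersPannekoek2017, Thm. 1 and Cor. 2] -/
theorem padicPoint_eq_zero_of_isIsogenous_five_of_semistabilityIndex (hp5 : p = 5)
    (hadd : Addv W p) (hj : 0 ≤ padicValRat p W.j) (he4 : semistabilityIndex W p ≠ 4)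
    (he6 : semistabilityIndex W p ≠ 6)
    {W' : WeierstrassCurve ℚ} [W'.IsElliptic] (hiso : IsIsogenous W W')
    (P : (W'.baseChange ℚ_[p]).toAffine.Point) (hP : p • P = 0) : P = 0 :=
  padicPoint_eq_zero_of_isIsogenous_of_semistabilityIndex (by omega) hadd hj (fun _ ↦ ⟨he4, he6⟩)
    (fun h ↦ by omega) hiso P hP

/-- **Row form in the TFMD/EF57 binder currency.** `W` globally minimal, additive at `p`, `W ⊗ χ_{p*}` neither good
nor multiplicative at `p`, on the rows `(5; v₅ Δ_min ∈ {4, 8})` (IV/IV*) or `(7; v₇ Δ_min ∈ {3, 4, 8, 9})`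
(III/IV/IV*/III* — supersingular AND ordinary): NO curve `ℚ`-isogenous to `W` has a `ℚ_p`-rational point of order
`p`. The Raynaud rows `(5;4),(5;8),(7;3),(7;9)` are TFMD's S16a (`TwistFamilyManinDescent.RaynaudRegimeClassNoLocalPTorsion`,
p624109); the rows `(7;4),(7;8)` are the ordinary `e = 3` classes at `7`. UNCONDITIONAL.
[cite: Mazur1977, Ch. III §5, Step 1, p. 158] [cite: SilvermanATAEC1994, IV Table 4.1 (PDF p. 365), V.5.3] -/
theorem padicPoint_eq_zero_of_isIsogenous_of_rows
    (hrow : (p = 5 ∧ padicValInt 5 W.minimalDiscriminantInt ∈ ({4, 8} : Finset ℕ)) ∨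
      (p = 7 ∧ padicValInt 7 W.minimalDiscriminantInt ∈ ({3, 4, 8, 9} : Finset ℕ)))
    (hadd : Addv W p)
    (htw : ¬ ((W.quadraticTwist (((-1 : ℤ) ^ (p / 2) * p : ℤ) : ℚ)).HasGoodReductionAt
          ((Rat.HeightOneSpectrum.primesEquiv (R := ℤ)).symm ⟨p, hp.out⟩) ∨
        (W.quadraticTwist (((-1 : ℤ) ^ (p / 2) * p : ℤ) : ℚ)).HasMultiplicativeReductionAt
          ((Rat.HeightOneSpectrum.primesEquiv (R := ℤ)).symm ⟨p, hp.out⟩)))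
    {W' : WeierstrassCurve ℚ} [W'.IsElliptic] (hiso : IsIsogenous W W')
    (P : (W'.baseChange ℚ_[p]).toAffine.Point) (hP : p • P = 0) : P = 0 := by
  have hp57 : p = 5 ∨ p = 7 := hrow.elim (fun h ↦ Or.inl h.1) (fun h ↦ Or.inr h.1)
  have hp5 : 5 ≤ p := by rcases hp57 with rfl | rfl <;> norm_num
  have hj : 0 ≤ padicValRat p W.j :=
    padicValRat_j_nonneg_of_addv_of_not_semistable_quadraticTwist_pStar (by omega) hadd htw
  refine padicPoint_eq_zero_of_isIsogenous_of_semistabilityIndex hp5 hadd hj ?_ ?_ hiso P hP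
  · rintro rfl
    rcases hrow with ⟨-, h⟩ | ⟨h7, -⟩
    · unfold semistabilityIndex
      simp only [Finset.mem_insert, Finset.mem_singleton] at h
      rcases h with h | h <;> rw [h] <;> decide
    · omega
  · rintro rfl
    rcases hrow with ⟨h5, -⟩ | ⟨-, h⟩
    · omega
    · unfold semistabilityIndex
      simp only [Finset.mem_insert, Finset.mem_singleton] at h
      rcases h with h | h | h | h <;> rw [h] <;> decide

end Defect

end Summit.BirchSwinnertonDyer.BirchSwinnertonDyer.Theorems.TwistFamilyManinDescent

end
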